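import Summits.QuantumFields.BalabanUV.Beta.SpineRecursiveWEndSym
import Summits.QuantumFields.BalabanUV.Beta.ReflectionLocusSymPure
import Summits.QuantumFields.BalabanUV.Beta.SpineRecursiveInductive

/-!
# `BalabanUV.Beta.SpineRecursiveWEndSymTables` — binder row D1, (N7d-ii) of the second-order hR slot port: **THE (Wr-conj-c) LAW OF THE (0.4) LITERAL's
# W-TABLES OVER A TABLE RECORD `tabs : SymTables 3 Lc` AT an1's TYPED SHIFT `DshAn1.Dsh Lc` AND THE LITERAL's PINS `(cE, cVH) = (Lc⁴, −Lc⁸∕2)`, EVERY LEVEL,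
# FROM THE TABLE LETTERS** — `SpineRecursiveWEndSym.WrecOf_brefC_of_letters_sym` at `d = 3`, `(V, H, vh₂S, mixFF) := (tabs.V, tabs.H, tabs.vh₂S, tabs.mixFF)`,
# with the pure tables' first-order law DISCHARGED from (V-r)(V-ff0)(H-r) (`ReflectionLocusSymPure.SpureSymOf_bref_all`), the first units lock DISCHARGED
# from the pin (`locks_of_pin`∕`pin_of_bcj`), and EVERY SHIFT LETTER of `Dsh Lc` DISCHARGED ((Dspr) `spr_Dsh`, (Dnull) `comp_comp_symEc_Dsh_symEc`,
# (Dff)(Dmm) `rfl`, (DG) `SymShiftGaugeBlind` from (Dgrad)(Dskew) — the discharges of `SpureSymOf_bref_all_an1Shift` verbatim); multiplier tables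
# `M1Of 3 Lc tabs.H cΛ` (= `tabs.M` by `rfl` at an1's record `symTablesAn1`)
# (β sub-cell, BINDER-OWNERS row D1 OWNER `b2b-balaban-beta-an2`, gen 31; memo `gen31/JSB12SYM-SPINE.v1.8.md` §11.4 (ii))

HONEST FRAMING (cell charter, verbatim): «discharging BetaPertH makes Bałaban's UV stability UNCONDITIONAL — a real constructive-QFT result; it is
NOT the continuum limit and NOT the Clay problem.»  HONEST DEPENDENCY: continuum YM on T⁴ ⇐ BetaPertH ∧ nine spine estimates (0/9 proved); BetaPertH
⇐ (D1) ∧ (D4) ∧ CAP+tail; G-an2-4 gates asym, D1 and NE2/3/4.  DERIVED cell leaf (wiring, [folklore]); no statement of Bałaban's papers, no `[cite:]`, no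
`def`, no `Prop` fact; EVERY second-order LETTER IS A HYPOTHESIS; instantiates no binder of the wall BY ITSELF.  NOT D1, NOT `BetaPertH`, NOT continuum, NOT Clay.

WHAT.  **`WrecOf_brefC_of_tableLetters_sym`**: for `tabs : SymTables 3 Lc`, `Odd Lc`, the first-order TABLE letters (V-r) (three border leg pairs, every axis,
generator `ctGenM 3 (bhK Lc + Dsh Lc)`), (V-ff0), (H-r) of `tabs.V`∕`tabs.H`, the contact coefficients `γ j = −(Lc⁸∕2)·wVH j∕(stepScale j·Lc⁴)` (the root's
`hγ`, verbatim), the second units lock `cE₂·wV4 (j+1)·wVH (j+1) = (Lc⁴·wE (j+1))²`, and the second-order letters of `SpineRecursiveT2AllSym` at the literal's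
data (level-0 letter, mixed letter ∀ j, border letter ∀ j+1 against `bhKStepSh 3 Lc (Dsh Lc) (j+1)`, split identities, localisations, remainder recursion
with the four inner sandwich-defect words): for all `j α μ y ν y′`,
`W_j μ (bref y) ν (bref y′) = (ε ε) • refK (W_j μ y ν y′ + conjW (bhKStepSh 3 Lc (Dsh Lc) j) (vertexOfK G_j Lc (SrecOf … j) μ y) (…ν y′)
(vertexOfK G_j Lc (γ_j • diagK (ctGenM 3 (bhK Lc + Dsh Lc) α Lc ·)) μ y) (…ν y′) (diagK (X2s j α μ y ν y′)) + Rm_j α μ y ν y′)`,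
`W_j := WrecOf 3 Lc (Gsym Lc) (SpureRecOf 3 Lc tabs.V tabs.H (Gsym Lc) Lc⁴ (−Lc⁸∕2) cΛ) (M1Of 3 Lc tabs.H cΛ) cE₂ cB T tabs.vh₂S tabs.mixFF j` — which for
`tabs := symTablesAn1 …`, `(cE₂, T) := (Lc⁸, (8N²)⁻¹ • wsym22 N)` IS `(JsB12Sym0 hLc N tabs cΛ cB j).W` (`JsB12Sym0_eq`, `JsSym0Of_W`, `WsymOf_eq`; `Gsym Lc j` =
`coDressKSymAt (toSite (ctrOff 4 Lc)) Lc (KInvStep Lc j)` by `rfl`), i.e. **the root's hypothesis `hWrC` (p273819) with `X₂ := diagK X2s`, `Wc := Rm`**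
(the re-rooting (N7e) is not in this file).
Provenance: β sub-cell, unit beta-an2 gen 31, 2026-08-21 (v1); no existing file touched.
-/

open Finset
open scoped BigOperators
open Literature.Probability.LatticeModels (Torus.proj)
open Literature.MathematicalPhysics.QuantumFieldTheory
open Literature.MathematicalPhysics.QuantumFieldTheory.Balaban1983to89
open Literature.MathematicalPhysics.QuantumFieldTheory.Balaban1983to89.Beta
open ExpKernelCalculus (MKer Decays BiLoc comp VertexFamily)
open PolarizationSign (reflSign)
open KernelReflection (refK)
open ResolventReflection (bref Φ)
open AffineAveraging (unitVec)
open AveragingContours (blk)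
open LatticeForm (quo)
open OneStepResolventKernel (Fib LocStencil)
open OneStepKernelFamily (KInvStep colH vertexOfK)
open BalabanStepJetsSucc (mmRead wE wVH)
open BalabanStepW2 (M2Of wV4 wB2)
open BalabanCompositeJets (LocStencil₂)
open SecondOrderResponse (dM W2OfK LocStencilFM)
open Summit.QuantumFields.BalabanUV.Beta.TameKernelCalculus
open Summit.QuantumFields.BalabanUV.Beta.ChartConjugation (conjV conjW)
open Summit.QuantumFields.BalabanUV.Beta.AxialDressingRooted (one_le_of_neZero)
open Summit.QuantumFields.BalabanUV.Beta.BorderedHessian (bhK diagK stepScale stepScale_ne_zero)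
open Summit.QuantumFields.BalabanUV.Beta.SymSliceProjectorKernel (symEc)
open Summit.QuantumFields.BalabanUV.Beta.WardLocusCubic (mmSym)
open Summit.QuantumFields.BalabanUV.Beta.WardLocusRecursive (SrecOf)
open Summit.QuantumFields.BalabanUV.Beta.ChartConjugationDefectEnd (sandwichDefect)
open Summit.QuantumFields.BalabanUV.Beta.SymmetrisedStepJets (SymTables Gsym SpureSymOf)
open Summit.QuantumFields.BalabanUV.Beta.SymShiftedSpread (bhKStepSh)
open Summit.QuantumFields.BalabanUV.Beta.E3ContactGenerator (ctGenM)
open Summit.QuantumFields.BalabanUV.Beta.VertexReflectionContact (smul_diagK)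
open Summit.QuantumFields.BalabanUV.Beta.ReflectionLocusSymPure (SpureSymOf_bref_all)
open Summit.QuantumFields.BalabanUV.Beta.DshAn1 (Dsh lam04 Dsh_inl_inl Dsh_inr_inr Dsh_inr_inl_eq_neg Dsh_inl_inr_eq_sub lam04_eq_zero_of_ne_blk spr_Dsh
  comp_comp_symEc_Dsh_symEc)
open Summit.QuantumFields.BalabanUV.Beta.SymShiftGaugeBlind (comp_Gsym_Dsh_inr_inl_of_grad comp_Dsh_Gsym_inl_inr_of_grad)

noncomputable section

namespace Summit.QuantumFields.BalabanUV.Beta.SpineRooted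

section WEndSymTables

variable {Lc : ℕ} [NeZero Lc]

/-- [folklore] **THE (Wr-conj-c) LAW OF THE (0.4) LITERAL's W-TABLES OVER A TABLE RECORD AT an1's SHIFT AND THE LITERAL's PINS, EVERY LEVEL, FROM THE
TABLE LETTERS** (see the module docstring). -/
theorem WrecOf_brefC_of_tableLetters_sym (hLc : Odd Lc) (tabs : SymTables 3 Lc) (cΛ cE₂ cB : ℝ) (T : Fin 4 → Fin 4 → Fin 4 → Fin 4 → ℝ)
    -- the first-order TABLE letters (V-r) (three border leg pairs, every axis), (V-ff0), (H-r)
    (hVfm : ∀ (α κ' : Fin 4) (u x z : Fin 4 → ℤ) (β μ : Fin 4), tabs.V κ' (bref α κ' u) x z (Sum.inl β) (Sum.inr μ) =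
      (reflSign α κ' • refK (Φ (d := 3) Lc α) (tabs.V κ' u + conjV (bhK (d := 3) Lc + Dsh Lc)
        ((((Lc : ℝ) ^ 4)⁻¹) • diagK (ctGenM 3 (bhK Lc + Dsh Lc) α Lc κ' u)))) x z (Sum.inl β) (Sum.inr μ))
    (hVmf : ∀ (α κ' : Fin 4) (u x z : Fin 4 → ℤ) (μ β : Fin 4), tabs.V κ' (bref α κ' u) x z (Sum.inr μ) (Sum.inl β) =
      (reflSign α κ' • refK (Φ (d := 3) Lc α) (tabs.V κ' u + conjV (bhK (d := 3) Lc + Dsh Lc)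
        ((((Lc : ℝ) ^ 4)⁻¹) • diagK (ctGenM 3 (bhK Lc + Dsh Lc) α Lc κ' u)))) x z (Sum.inr μ) (Sum.inl β))
    (hVmm : ∀ (α κ' : Fin 4) (u x z : Fin 4 → ℤ) (μ μ' : Fin 4), tabs.V κ' (bref α κ' u) x z (Sum.inr μ) (Sum.inr μ') =
      (reflSign α κ' • refK (Φ (d := 3) Lc α) (tabs.V κ' u + conjV (bhK (d := 3) Lc + Dsh Lc)
        ((((Lc : ℝ) ^ 4)⁻¹) • diagK (ctGenM 3 (bhK Lc + Dsh Lc) α Lc κ' u)))) x z (Sum.inr μ) (Sum.inr μ'))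
    (hV0 : ∀ (κ : Fin 4) (w x z : Fin 4 → ℤ) (β β' : Fin 4), tabs.V κ w x z (Sum.inl β) (Sum.inl β') = 0)
    (hHr : ∀ (α μ : Fin 4) (y : Fin 4 → ℤ), tabs.H μ (bref α μ y) = reflSign α μ • refK (Φ (d := 3) Lc α) (tabs.H μ y))
    (hB0 : ∀ κ u κ' u' (x z : Fin 4 → ℤ) (β β' : Fin 4), tabs.vh₂S κ u κ' u' x z (Sum.inl β) (Sum.inl β') = 0)
    -- the first-order contact coefficients (the root's `hγ`, verbatim) and the second units lock
    (γ : ℕ → ℝ) (hγ : ∀ j, γ j = -((Lc : ℝ) ^ 8 / 2) * wVH 3 Lc j / (stepScale 3 Lc j * (Lc : ℝ) ^ 4))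
    (hlock2 : ∀ j, cE₂ * wV4 3 Lc (j + 1) * wVH 3 Lc (j + 1) = ((Lc : ℝ) ^ 4 * wE 3 Lc (j + 1)) ^ 2)
    (h : ℕ → Fin 4 → Fin 4 → (Fin 4 → ℤ) → Fin 4 → (Fin 4 → ℤ) → (Fin 4 → ℤ) → Fib 3 → ℝ)
    (R2 : ℕ → Fin 4 → Fin 4 → (Fin 4 → ℤ) → Fin 4 → (Fin 4 → ℤ) → MKer 4 (Fib 3))
    (RM : ℕ → Fin 4 → Fin 4 → (Fin 4 → ℤ) → Fin 4 → (Fin 4 → ℤ) → MKer 4 (Fib 3))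
    (h0 : ∀ (α κ : Fin 4) (u : Fin 4 → ℤ) (κ' : Fin 4) (u' : Fin 4 → ℤ),
      T2RecOf 3 Lc (Gsym Lc) (SpureRecOf 3 Lc tabs.V tabs.H (Gsym Lc) ((Lc : ℝ) ^ 4) (-((Lc : ℝ) ^ 8 / 2)) cΛ) (M1Of 3 Lc tabs.H cΛ) cE₂ cB T tabs.vh₂S tabs.mixFF 0 κ (bref α κ u) κ' (bref α κ' u') =
        (reflSign α κ * reflSign α κ') • refK (Φ Lc α)
          (T2RecOf 3 Lc (Gsym Lc) (SpureRecOf 3 Lc tabs.V tabs.H (Gsym Lc) ((Lc : ℝ) ^ 4) (-((Lc : ℝ) ^ 8 / 2)) cΛ) (M1Of 3 Lc tabs.H cΛ) cE₂ cB T tabs.vh₂S tabs.mixFF 0 κ u κ' u' +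
            conjW (bhKStepSh 3 Lc (Dsh Lc) 0) (SpureRecOf 3 Lc tabs.V tabs.H (Gsym Lc) ((Lc : ℝ) ^ 4) (-((Lc : ℝ) ^ 8 / 2)) cΛ 0 κ u) (SpureRecOf 3 Lc tabs.V tabs.H (Gsym Lc) ((Lc : ℝ) ^ 4) (-((Lc : ℝ) ^ 8 / 2)) cΛ 0 κ' u')
              (diagK fun p c => γ 0 * ctGenM 3 (bhK Lc + Dsh Lc) α Lc κ u p c) (diagK fun p c => γ 0 * ctGenM 3 (bhK Lc + Dsh Lc) α Lc κ' u' p c) (diagK (h 0 α κ u κ' u')) +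
            R2 0 α κ u κ' u'))
    (hM2 : ∀ (j : ℕ) (α κ : Fin 4) (u : Fin 4 → ℤ) (ρ : Fin 4) (w : Fin 4 → ℤ),
      M2Of 3 Lc tabs.mixFF j κ (bref α κ u) ρ (bref α ρ w) =
        (reflSign α κ * reflSign α ρ) • refK (Φ Lc α)
          (M2Of 3 Lc tabs.mixFF j κ u ρ w + conjV (M1Of 3 Lc tabs.H cΛ j ρ w) (diagK fun p c => γ j * ctGenM 3 (bhK Lc + Dsh Lc) α Lc κ u p c) + RM j α κ u ρ w))
    (X2s : ℕ → Fin 4 → Fin 4 → (Fin 4 → ℤ) → Fin 4 → (Fin 4 → ℤ) → (Fin 4 → ℤ) → Fib 3 → ℝ)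
    (Δ : ℕ → Fin 4 → Fin 4 → (Fin 4 → ℤ) → Fin 4 → (Fin 4 → ℤ) → MKer 4 (Fib 3))
    (hsplit : ∀ (j : ℕ) (α μ : Fin 4) (y : Fin 4 → ℤ) (ν : Fin 4) (y' : Fin 4 → ℤ),
      W2OfK (Gsym (d := 3) Lc j) Lc
          (fun κ u => SpureRecOf 3 Lc tabs.V tabs.H (Gsym Lc) ((Lc : ℝ) ^ 4) (-((Lc : ℝ) ^ 8 / 2)) cΛ j κ u + conjV (bhKStepSh 3 Lc (Dsh Lc) j) (diagK fun p c => γ j * ctGenM 3 (bhK Lc + Dsh Lc) α Lc κ u p c))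
          (M1Of 3 Lc tabs.H cΛ j)
          (fun κ u κ' u' => T2RecOf 3 Lc (Gsym Lc) (SpureRecOf 3 Lc tabs.V tabs.H (Gsym Lc) ((Lc : ℝ) ^ 4) (-((Lc : ℝ) ^ 8 / 2)) cΛ) (M1Of 3 Lc tabs.H cΛ) cE₂ cB T tabs.vh₂S tabs.mixFF j κ u κ' u' +
            conjW (bhKStepSh 3 Lc (Dsh Lc) j) (SpureRecOf 3 Lc tabs.V tabs.H (Gsym Lc) ((Lc : ℝ) ^ 4) (-((Lc : ℝ) ^ 8 / 2)) cΛ j κ u) (SpureRecOf 3 Lc tabs.V tabs.H (Gsym Lc) ((Lc : ℝ) ^ 4) (-((Lc : ℝ) ^ 8 / 2)) cΛ j κ' u')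
              (diagK fun p c => γ j * ctGenM 3 (bhK Lc + Dsh Lc) α Lc κ u p c) (diagK fun p c => γ j * ctGenM 3 (bhK Lc + Dsh Lc) α Lc κ' u' p c) (diagK (h j α κ u κ' u')) +
            R2 j α κ u κ' u')
          (fun κ u ρ w => M2Of 3 Lc tabs.mixFF j κ u ρ w + conjV (M1Of 3 Lc tabs.H cΛ j ρ w) (diagK fun p c => γ j * ctGenM 3 (bhK Lc + Dsh Lc) α Lc κ u p c) + RM j α κ u ρ w)
          μ y ν y' =
        W2OfK (Gsym (d := 3) Lc j) Lc (SpureRecOf 3 Lc tabs.V tabs.H (Gsym Lc) ((Lc : ℝ) ^ 4) (-((Lc : ℝ) ^ 8 / 2)) cΛ j) (M1Of 3 Lc tabs.H cΛ j)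
            (T2RecOf 3 Lc (Gsym Lc) (SpureRecOf 3 Lc tabs.V tabs.H (Gsym Lc) ((Lc : ℝ) ^ 4) (-((Lc : ℝ) ^ 8 / 2)) cΛ) (M1Of 3 Lc tabs.H cΛ) cE₂ cB T tabs.vh₂S tabs.mixFF j)
            (M2Of 3 Lc tabs.mixFF j) μ y ν y' +
          conjW (bhKStepSh 3 Lc (Dsh Lc) j)
            (dM (Gsym Lc j) Lc (SpureRecOf 3 Lc tabs.V tabs.H (Gsym Lc) ((Lc : ℝ) ^ 4) (-((Lc : ℝ) ^ 8 / 2)) cΛ j) (M1Of 3 Lc tabs.H cΛ j) μ y)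
            (dM (Gsym Lc j) Lc (SpureRecOf 3 Lc tabs.V tabs.H (Gsym Lc) ((Lc : ℝ) ^ 4) (-((Lc : ℝ) ^ 8 / 2)) cΛ j) (M1Of 3 Lc tabs.H cΛ j) ν y')
            (diagK fun p c => ∑ κ, ∑' u, colH (Gsym Lc j) Lc μ y κ u * (γ j * ctGenM 3 (bhK Lc + Dsh Lc) α Lc κ u p c))
            (diagK fun p c => ∑ κ, ∑' u, colH (Gsym Lc j) Lc ν y' κ u * (γ j * ctGenM 3 (bhK Lc + Dsh Lc) α Lc κ u p c))
            (diagK (X2s j α μ y ν y')) +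
          Δ j α μ y ν y')
    (hDg : ∀ (j : ℕ) (α ν : Fin 4) (y' : Fin 4 → ℤ),
      Loc (dM (Gsym (d := 3) Lc j) Lc (fun κ u => SpureRecOf 3 Lc tabs.V tabs.H (Gsym Lc) ((Lc : ℝ) ^ 4) (-((Lc : ℝ) ^ 8 / 2)) cΛ j κ u + conjV (bhKStepSh 3 Lc (Dsh Lc) j) (diagK fun p c => γ j * ctGenM 3 (bhK Lc + Dsh Lc) α Lc κ u p c)) (M1Of 3 Lc tabs.H cΛ j) ν y'))
    (hX2L : ∀ j α μ y ν y', Loc (diagK (X2s j α μ y ν y'))) (hΔL : ∀ j α μ y ν y', Loc (Δ j α μ y ν y'))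
    (RB : ℕ → Fin 4 → Fin 4 → (Fin 4 → ℤ) → Fin 4 → (Fin 4 → ℤ) → MKer 4 (Fib 3))
    (hRBff : ∀ j α κ u κ' u' (x z : Fin 4 → ℤ) (β β' : Fin 4), RB j α κ u κ' u' x z (Sum.inl β) (Sum.inl β') = 0)
    (hBfm : ∀ (j : ℕ) (α : Fin 4) κ u κ' u' (x z : Fin 4 → ℤ) (β m : Fin 4),
      ((cB * wB2 3 Lc (j + 1)) • tabs.vh₂S κ (bref α κ u) κ' (bref α κ' u')) x z (Sum.inl β) (Sum.inr m) =
        ((reflSign α κ * reflSign α κ') • refK (Φ Lc α) ((cB * wB2 3 Lc (j + 1)) • tabs.vh₂S κ u κ' u' +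
          conjW (bhKStepSh 3 Lc (Dsh Lc) (j + 1)) (SpureRecOf 3 Lc tabs.V tabs.H (Gsym Lc) ((Lc : ℝ) ^ 4) (-((Lc : ℝ) ^ 8 / 2)) cΛ (j + 1) κ u) (SpureRecOf 3 Lc tabs.V tabs.H (Gsym Lc) ((Lc : ℝ) ^ 4) (-((Lc : ℝ) ^ 8 / 2)) cΛ (j + 1) κ' u')
            (diagK fun p c => γ (j + 1) * ctGenM 3 (bhK Lc + Dsh Lc) α Lc κ u p c) (diagK fun p c => γ (j + 1) * ctGenM 3 (bhK Lc + Dsh Lc) α Lc κ' u' p c)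
            (diagK (h (j + 1) α κ u κ' u')) + RB (j + 1) α κ u κ' u')) x z (Sum.inl β) (Sum.inr m))
    (hBmf : ∀ (j : ℕ) (α : Fin 4) κ u κ' u' (x z : Fin 4 → ℤ) (m β : Fin 4),
      ((cB * wB2 3 Lc (j + 1)) • tabs.vh₂S κ (bref α κ u) κ' (bref α κ' u')) x z (Sum.inr m) (Sum.inl β) =
        ((reflSign α κ * reflSign α κ') • refK (Φ Lc α) ((cB * wB2 3 Lc (j + 1)) • tabs.vh₂S κ u κ' u' +
          conjW (bhKStepSh 3 Lc (Dsh Lc) (j + 1)) (SpureRecOf 3 Lc tabs.V tabs.H (Gsym Lc) ((Lc : ℝ) ^ 4) (-((Lc : ℝ) ^ 8 / 2)) cΛ (j + 1) κ u) (SpureRecOf 3 Lc tabs.V tabs.H (Gsym Lc) ((Lc : ℝ) ^ 4) (-((Lc : ℝ) ^ 8 / 2)) cΛ (j + 1) κ' u')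
            (diagK fun p c => γ (j + 1) * ctGenM 3 (bhK Lc + Dsh Lc) α Lc κ u p c) (diagK fun p c => γ (j + 1) * ctGenM 3 (bhK Lc + Dsh Lc) α Lc κ' u' p c)
            (diagK (h (j + 1) α κ u κ' u')) + RB (j + 1) α κ u κ' u')) x z (Sum.inr m) (Sum.inl β))
    (hBmm : ∀ (j : ℕ) (α : Fin 4) κ u κ' u' (x z : Fin 4 → ℤ) (m m' : Fin 4),
      ((cB * wB2 3 Lc (j + 1)) • tabs.vh₂S κ (bref α κ u) κ' (bref α κ' u')) x z (Sum.inr m) (Sum.inr m') =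
        ((reflSign α κ * reflSign α κ') • refK (Φ Lc α) ((cB * wB2 3 Lc (j + 1)) • tabs.vh₂S κ u κ' u' +
          conjW (bhKStepSh 3 Lc (Dsh Lc) (j + 1)) (SpureRecOf 3 Lc tabs.V tabs.H (Gsym Lc) ((Lc : ℝ) ^ 4) (-((Lc : ℝ) ^ 8 / 2)) cΛ (j + 1) κ u) (SpureRecOf 3 Lc tabs.V tabs.H (Gsym Lc) ((Lc : ℝ) ^ 4) (-((Lc : ℝ) ^ 8 / 2)) cΛ (j + 1) κ' u')
            (diagK fun p c => γ (j + 1) * ctGenM 3 (bhK Lc + Dsh Lc) α Lc κ u p c) (diagK fun p c => γ (j + 1) * ctGenM 3 (bhK Lc + Dsh Lc) α Lc κ' u' p c)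
            (diagK (h (j + 1) α κ u κ' u')) + RB (j + 1) α κ u κ' u')) x z (Sum.inr m) (Sum.inr m'))
    (hR2succ : ∀ (j : ℕ) (α κ : Fin 4) (u : Fin 4 → ℤ) (κ' : Fin 4) (u' : Fin 4 → ℤ),
      R2 (j + 1) α κ u κ' u' =
          (-((cE₂ * wV4 3 Lc (j + 1)) • mmRead Lc
              (comp (comp (Gsym Lc j) (((1 / 2 : ℝ) • conjV (bhKStepSh 3 Lc (Dsh Lc) j) (diagK fun p a => X2s j α κ' u' κ u p a - X2s j α κ u κ' u' p a) +
                (1 / 2 : ℝ) • (Δ j α κ u κ' u' + Δ j α κ' u' κ u)))) (Gsym Lc j) -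
                (comp (sandwichDefect (Gsym Lc j) (bhKStepSh 3 Lc (Dsh Lc) j)
                      (diagK fun p c => ∑ ι, ∑' v, colH (Gsym Lc j) Lc κ u ι v * (γ j * ctGenM 3 (bhK Lc + Dsh Lc) α Lc ι v p c)))
                    (comp (dM (Gsym Lc j) Lc (SpureRecOf 3 Lc tabs.V tabs.H (Gsym Lc) ((Lc : ℝ) ^ 4) (-((Lc : ℝ) ^ 8 / 2)) cΛ j) (M1Of 3 Lc tabs.H cΛ j) κ' u') (Gsym Lc j) -
                      diagK fun p c => ∑ ι, ∑' v, colH (Gsym Lc j) Lc κ' u' ι v * (γ j * ctGenM 3 (bhK Lc + Dsh Lc) α Lc ι v p c))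
                  + comp (comp (Gsym Lc j) (dM (Gsym Lc j) Lc (SpureRecOf 3 Lc tabs.V tabs.H (Gsym Lc) ((Lc : ℝ) ^ 4) (-((Lc : ℝ) ^ 8 / 2)) cΛ j) (M1Of 3 Lc tabs.H cΛ j) κ u +
                      conjV (bhKStepSh 3 Lc (Dsh Lc) j) (diagK fun p c => ∑ ι, ∑' v, colH (Gsym Lc j) Lc κ u ι v * (γ j * ctGenM 3 (bhK Lc + Dsh Lc) α Lc ι v p c))))
                    (sandwichDefect (Gsym Lc j) (bhKStepSh 3 Lc (Dsh Lc) j)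
                      (diagK fun p c => ∑ ι, ∑' v, colH (Gsym Lc j) Lc κ' u' ι v * (γ j * ctGenM 3 (bhK Lc + Dsh Lc) α Lc ι v p c)))
                  + comp (sandwichDefect (Gsym Lc j) (bhKStepSh 3 Lc (Dsh Lc) j)
                      (diagK fun p c => ∑ ι, ∑' v, colH (Gsym Lc j) Lc κ' u' ι v * (γ j * ctGenM 3 (bhK Lc + Dsh Lc) α Lc ι v p c)))
                    (comp (dM (Gsym Lc j) Lc (SpureRecOf 3 Lc tabs.V tabs.H (Gsym Lc) ((Lc : ℝ) ^ 4) (-((Lc : ℝ) ^ 8 / 2)) cΛ j) (M1Of 3 Lc tabs.H cΛ j) κ u) (Gsym Lc j) -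
                      diagK fun p c => ∑ ι, ∑' v, colH (Gsym Lc j) Lc κ u ι v * (γ j * ctGenM 3 (bhK Lc + Dsh Lc) α Lc ι v p c))
                  + comp (comp (Gsym Lc j) (dM (Gsym Lc j) Lc (SpureRecOf 3 Lc tabs.V tabs.H (Gsym Lc) ((Lc : ℝ) ^ 4) (-((Lc : ℝ) ^ 8 / 2)) cΛ j) (M1Of 3 Lc tabs.H cΛ j) κ' u' +
                      conjV (bhKStepSh 3 Lc (Dsh Lc) j) (diagK fun p c => ∑ ι, ∑' v, colH (Gsym Lc j) Lc κ' u' ι v * (γ j * ctGenM 3 (bhK Lc + Dsh Lc) α Lc ι v p c))))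
                    (sandwichDefect (Gsym Lc j) (bhKStepSh 3 Lc (Dsh Lc) j)
                      (diagK fun p c => ∑ ι, ∑' v, colH (Gsym Lc j) Lc κ u ι v * (γ j * ctGenM 3 (bhK Lc + Dsh Lc) α Lc ι v p c)))))) +
            RB (j + 1) α κ u κ' u' +
            conjV (mmRead Lc (Gsym (d := 3) Lc j))
              (diagK fun p c => cE₂ * wV4 3 Lc (j + 1) * mmSym Lc (X2s j α κ u κ' u') p c - wVH 3 Lc (j + 1) * h (j + 1) α κ u κ' u' p c))) :
    ∀ (j : ℕ) (α μ : Fin 4) (y : Fin 4 → ℤ) (ν : Fin 4) (y' : Fin 4 → ℤ),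
      WrecOf 3 Lc (Gsym Lc) (SpureRecOf 3 Lc tabs.V tabs.H (Gsym Lc) ((Lc : ℝ) ^ 4) (-((Lc : ℝ) ^ 8 / 2)) cΛ) (M1Of 3 Lc tabs.H cΛ) cE₂ cB T tabs.vh₂S tabs.mixFF j μ (bref α μ y) ν (bref α ν y') =
        (reflSign α μ * reflSign α ν) • refK (Φ Lc α)
          (WrecOf 3 Lc (Gsym Lc) (SpureRecOf 3 Lc tabs.V tabs.H (Gsym Lc) ((Lc : ℝ) ^ 4) (-((Lc : ℝ) ^ 8 / 2)) cΛ) (M1Of 3 Lc tabs.H cΛ) cE₂ cB T tabs.vh₂S tabs.mixFF j μ y ν y' +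
            conjW (bhKStepSh 3 Lc (Dsh Lc) j)
              (vertexOfK (Gsym (d := 3) Lc j) Lc (SrecOf 3 Lc tabs.V tabs.H (Gsym Lc) ((Lc : ℝ) ^ 4) (-((Lc : ℝ) ^ 8 / 2)) cΛ j) μ y)
              (vertexOfK (Gsym (d := 3) Lc j) Lc (SrecOf 3 Lc tabs.V tabs.H (Gsym Lc) ((Lc : ℝ) ^ 4) (-((Lc : ℝ) ^ 8 / 2)) cΛ j) ν y')
              (vertexOfK (Gsym (d := 3) Lc j) Lc (fun κ u => γ j • diagK (ctGenM 3 (bhK Lc + Dsh Lc) α Lc κ u)) μ y)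
              (vertexOfK (Gsym (d := 3) Lc j) Lc (fun κ u => γ j • diagK (ctGenM 3 (bhK Lc + Dsh Lc) α Lc κ u)) ν y')
              (diagK (X2s j α μ y ν y')) +
            ((1 / 2 : ℝ) • conjV (bhKStepSh 3 Lc (Dsh Lc) j) (diagK fun p a => X2s j α ν y' μ y p a - X2s j α μ y ν y' p a) +
              (1 / 2 : ℝ) • (Δ j α μ y ν y' + Δ j α ν y' μ y))) := by
  have hLc1 : 1 ≤ Lc := one_le_of_neZero Lc
  -- the shift letters at an1's `Dsh Lc` ((Dspr)(Dnull)(Dff)(Dmm) and (DG) from (Dgrad)(Dskew), as in `SpureSymOf_bref_all_an1Shift`)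
  have hDff : ∀ (x z : Fin 4 → ℤ) (β β' : Fin 4), Dsh Lc x z (Sum.inl β) (Sum.inl β') = 0 := fun x z β β' => Dsh_inl_inl Lc x z β β'
  have hDmm : ∀ (x y : Fin 4 → ℤ) (κ l : Fin 4), Dsh Lc x y (Sum.inr κ) (Sum.inr l) = 0 := fun x y κ l => Dsh_inr_inr Lc x y κ l
  have hDskew : ∀ (x z : Fin 4 → ℤ) (a' m : Fin 4), Dsh Lc x z (Sum.inl a') (Sum.inr m) = -Dsh Lc z x (Sum.inr m) (Sum.inl a') := fun x z a' m => by
    rw [Dsh_inr_inl_eq_neg, neg_neg]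
  have hDgrad : ∀ (z : Fin 4 → ℤ) (b : Fin 4), ∃ pot : (Fin 4 → ℤ) → ℝ, (Function.support pot).Finite ∧
      ∀ (x : Fin 4 → ℤ) (m : Fin 4), Torus.proj Lc x = 0 → Dsh Lc x z (Sum.inr m) (Sum.inl b) = pot (quo Lc x + unitVec m) - pot (quo Lc x) := fun z b =>
    ⟨fun Y => -lam04 Lc b z Y, (Set.finite_singleton (blk Lc z)).subset (fun Y hY => by
        by_contra hne
        apply hY
        show -lam04 Lc b z Y = 0
        rw [lam04_eq_zero_of_ne_blk hLc1 (fun h => hne (Set.mem_singleton_iff.mpr h)), neg_zero]),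
      fun x m hx => by rw [Dsh_inr_inl_eq_neg, Dsh_inl_inr_eq_sub, if_pos hx]; ring⟩
  have hGD : ∀ (j : ℕ) (x z : Fin 4 → ℤ) (m a : Fin 4), comp (Gsym (d := 3) Lc j) (Dsh Lc) x z (Sum.inr m) (Sum.inl a) = 0 :=
    fun j x z m b => comp_Gsym_Dsh_inr_inl_of_grad hDff hDgrad j x z m b
  have hDG : ∀ (j : ℕ) (x z : Fin 4 → ℤ) (a m : Fin 4), comp (Dsh Lc) (Gsym (d := 3) Lc j) x z (Sum.inl a) (Sum.inr m) = 0 :=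
    fun j x z a' m => comp_Dsh_Gsym_inl_inr_of_grad hDff hDskew hDgrad j x z a' m
  have e4 : ((Lc : ℝ) ^ (3 + 1)) = (Lc : ℝ) ^ 4 := by norm_num
  have e8 : -((Lc : ℝ) ^ 4 * (1 / 2) * (Lc : ℝ) ^ 4) = -((Lc : ℝ) ^ 8 / 2) := by ring
  -- the first units lock from the pin
  have hlock : ∀ j, (Lc : ℝ) ^ 4 * wE 3 Lc (j + 1) * (γ j / (stepScale 3 Lc j * (Lc : ℝ) ^ (3 + 1))) / wVH 3 Lc (j + 1) = γ (j + 1) := by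
    intro j
    have h1 := locks_of_pin (Lc := Lc) ((Lc : ℝ) ^ 4) (-((Lc : ℝ) ^ 8 / 2)) (pin_of_bcj (Lc := Lc) _ rfl) j
    rw [hγ, hγ, e4, ← h1]
    ring
  -- the pure tables' first-order law from the table letters, at the literal's pins
  have hSp : ∀ (j : ℕ) (α κ : Fin 4) (u : Fin 4 → ℤ),
      SpureRecOf 3 Lc tabs.V tabs.H (Gsym Lc) ((Lc : ℝ) ^ 4) (-((Lc : ℝ) ^ 8 / 2)) cΛ j κ (bref α κ u) =
        reflSign α κ • refK (Φ Lc α) (SpureRecOf 3 Lc tabs.V tabs.H (Gsym Lc) ((Lc : ℝ) ^ 4) (-((Lc : ℝ) ^ 8 / 2)) cΛ j κ u +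
          conjV (bhKStepSh 3 Lc (Dsh Lc) j) (diagK fun p c => γ j * ctGenM 3 (bhK Lc + Dsh Lc) α Lc κ u p c)) := by
    intro j α κ u
    have h := SpureSymOf_bref_all hLc tabs cΛ (spr_Dsh hLc1) (comp_comp_symEc_Dsh_symEc hLc1) hDff hDmm hGD hDG (hVfm α) (hVmf α) (hVmm α) hV0 hHr j κ u
    rw [e8, smul_diagK, ← hγ j] at h
    exact h
  exact WrecOf_brefC_of_letters_sym (d := 3) hLc (spr_Dsh hLc1) (comp_comp_symEc_Dsh_symEc hLc1) hDff hDmm hGD hDG tabs.hV tabs.hH hV0 hHr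
    ((Lc : ℝ) ^ 4) (-((Lc : ℝ) ^ 8 / 2)) cΛ cE₂ cB T tabs.hB hB0 tabs.hmix γ hlock hlock2 hSp h R2 RM h0 hM2 X2s Δ hsplit hDg hX2L hΔL RB hRBff hBfm
    hBmf hBmm hR2succ

end WEndSymTables

end Summit.QuantumFields.BalabanUV.Beta.SpineRooted

end
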